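import Summits.BirchSwinnertonDyer.Rank1Residual.Ordinary.DepthLawReciprocityFromPoitouTate
import Summits.BirchSwinnertonDyer.Rank1Residual.Ordinary.Conjectures.KuriharaExactOrderFromReciprocity
import Summits.BirchSwinnertonDyer.Rank1Residual.Ordinary.CyclicSylowQuotient
import Summits.BirchSwinnertonDyer.Rank1Residual.Ordinary.StrictSelmerIndexLetterAtThree
import HarnessLib

/-!
# C-16's clause ON ITS LETTER from the KOLYVAGIN CLASS ALONE: step (iii) and the local dualities of the
# depth-law derivation supplied by the Poitou–Tate fact (theorems only — no named fact minted, no `sorry`;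
# C-16 stays a CONJECTURE; nothing about any curve's BSD)

HONEST FRAMING (cell `b2b-bsdres`, run/shared/lean/b2b/bsd-rank1-residual/, verbatim in every
file): the goal of the cell is to DELETE the COMBINATION-SHAPED residual classes of the
Birch–Swinnerton-Dyer formula for ALL analytic-rank `≤ 1` elliptic curves over `ℚ` — "full BSD
formula for every rank `≤ 1` curve in class `C`" assembled STRICTLY from published theorems — so
that the rank-`≤ 1` remainder becomes exactly the CONSTRUCTION-SHAPED classes, which are TYPED
(missing-input `Prop`s), NOT attempted. This is not "finishing BSD". Seat `b2b-bsdres-additive-p3`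
(X8 prover B / X7 joint; typer-designate for the cell conjecture C-16 = hyp C120.1 by hyp R-16 (e)).
This file books nothing and moves no mark; X7 / X8 stay CONSTRUCTION-SHAPED; C-16 = CONJECTURE.

## What this file does

`Conjectures/KuriharaExactOrderFromReciprocity.lean` reduced C-16's clause `KuriharaExactOrderAt W f ℓ k P F`
on its letter to ONE per-`ψ` hypothesis schema = `R1-DEPTH-LAW.md` §2 (i)–(iv): identifications `φ_ℓ`, `φ₃`,
PERFECT pairings `Bl`, `Bp`, the RECIPROCITY `Bl xl yl + Bp xp yp = 0`, and Kim's reading. With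
`Ordinary/DepthLawReciprocityFromPoitouTate.lean` (step (iii) from the Poitou–Tate fact) the schema SHRINKS:

* §1 ports to the currency of the local/global cohomology files (`K_v = v.adicCompletion ℚ`): an
  identification `φ : E(ℚ_p) ↠ ℤ/q` on Mathlib's `ℚ_[p]`-points (the currency of `LocalPointsIdentification`)
  and an identification `φ : Ẽ(𝔽_ℓ) ↠ ℤ/q` with kernel `q·Ẽ(𝔽_ℓ)` (the currency of `CyclicSylowQuotient`,
  `ℓ ∤ q` good) ARE identifications `E(ℚ_v) ↠ ℤ/q` with kernel `q·E(ℚ_v)` for `v ∋ p` resp. `v ∋ ℓ`, compatibly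
  with the maps from `E(ℚ)` (`exists_pointIdentification_adicCompletion_of_padic/_of_reduction`; transport along
  `exists_pointAddEquiv_adicCompletion_padic_comp` and the tree's reduction homomorphism
  `exists_reductionHom` / `exists_nsmul_eq_iff_reduction`, AEC VII.2.1); distinct primes give distinct places;
* §2 **`kuriharaExactOrderAt_of_letter_kolyvaginClass`**: on C-16's letter (`3` good, `a₃ ∉ {1, −2}`,
  `m₃(P) = 0`, `ℓ` a cyclic Kolyvagin prime), GIVEN the two NAMED FACTS `poitouTate_sum_localTatePairing_eq_zero ℚ`
  (Milne I Thm. 4.10(b), Cor. 2.3) and Tate's `localEulerPoincareCharacteristic` at `ℚ_ℓ` and `ℚ₃` (Milne I Thm. 2.8)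
  as displayed hypotheses, the clause follows from the per-`ψ` schema: a depth `n ≥ k` with `ℓ ∈ 𝒫_n`, a unit
  `u` (`3 ∤ u`), **a class `x ∈ H¹(ℚ, E[3^n])` Kummer outside `{ℓ, 3}` whose singular part at `ℓ` is the image of
  `loc_ℓ κ((3^F·u)·P)` under SOME additive isomorphism `θ : 𝓛_ℓ ≅ H¹(ℚ_ℓ, E[3^n]) ⧸ 𝓛_ℓ`** (the Kolyvagin-system
  class `κ_ℓ` with the KS relation to `κ₁ = κ(3^F·u·P)`, `F = ∂⁰(κ)` on the letter — Kato + Mazur–Rubin 3.2.4 /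
  5.2.12 with `m₃ = 0`), **and Kim's reading `ord₃(δ̃_ℓ mod 3^k) = min(k, ord₃ [loc₃ x])`** for every
  identification of the singular quotient at `3` (Thm. 3.13 + (5.3); identification-blind by
  `ReciprocityPT.zmodPowOrd_addEquiv_congr`). The identifications `φ_ℓ`, `φ₃` (F14 / F12), the three local
  orders (F11), the reciprocity and both perfect pairings (F22) are now THEOREMS and no longer in the schema;
* §3 the closed sentence: `KuriharaExactOrderRankOneAtThree` from this smaller core quantified over the letter
  (`kuriharaExactOrderRankOneAtThree_of_letter_kolyvaginClass`).

Nothing asserted: the remaining schema is exactly the Kolyvagin-system layer (no `T`-adic / KS objects in the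
tree) and Kim's theorem at `p = 3` (printed for `p ≥ 5`); C-16 and the core stay OPEN.

References: `R1-DEPTH-LAW.md` §2; B. Mazur, K. Rubin, Mem. AMS 799 (2004), Thm. 3.2.4, Thm. 5.2.12
[MazurRubin2004]; C.-H. Kim, arXiv:2203.12159, Thm. 3.13, (5.3) [Kim2022StructureSelmer]; J. S. Milne, ADT (2006),
I 2.3, 2.8, 4.10(b) [MilneADT2006]; J. H. Silverman, AEC (2009), VII.2.1 [SilvermanAEC2009].
-/

noncomputable section

open scoped Classical MatrixGroups ModularForm

open CongruenceSubgroup WeierstrassCurve Literature.NumberTheory.EllipticCurves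
  Literature.NumberTheory.EllipticCurves.ModularForms
  Literature.NumberTheory.EllipticCurves.Rank1Residual
  Literature.NumberTheory.GaloisRepresentations Literature.NumberTheory.GaloisCohomology
  Function NumberField IsDedekindDomain

namespace Summit.BirchSwinnertonDyer.Rank1Residual.Ordinary

/-! ### §1 Ports: identifications in the currency of `v.adicCompletion ℚ`; distinct primes, distinct places -/

section Port

/-- Two distinct rational primes lie in distinct finite places: if `ℓ ∈ v` and `p ∈ w` with `ℓ, p` coprime then
`v ≠ w` (else `1 = aℓ + bp ∈ v`). [folklore] -/
theorem ReciprocityPT.ne_of_natCast_mem_asIdeal {K : Type*} [Field K] [NumberField K] {ℓ p : ℕ}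
    (hℓp : Nat.Coprime ℓ p) {v w : HeightOneSpectrum (𝓞 K)} (hv : (ℓ : 𝓞 K) ∈ v.asIdeal)
    (hw : (p : 𝓞 K) ∈ w.asIdeal) : v ≠ w := by
  rintro rfl
  obtain ⟨a, b, hab⟩ := Nat.isCoprime_iff_coprime.mpr hℓp
  apply v.isPrime.ne_top
  rw [Ideal.eq_top_iff_one]
  have h1 : ((a * ℓ + b * p : ℤ) : 𝓞 K) = 1 := by rw [hab, Int.cast_one]
  rw [← h1]
  push_cast
  exact v.asIdeal.add_mem (v.asIdeal.mul_mem_left _ hv) (v.asIdeal.mul_mem_left _ hw)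

variable (W : WeierstrassCurve ℚ) [W.IsElliptic] {v : HeightOneSpectrum (𝓞 ℚ)}

omit [W.IsElliptic] in
/-- **Port at `p`**: an identification `φ : E(ℚ_p) ↠ ℤ/q` with kernel `q·E(ℚ_p)` on Mathlib's `ℚ_[p]`-points IS
one on `E(ℚ_v)` (`v ∋ p`), `φ' := φ ∘ f` along the compatible `f : E(ℚ_v) ≅ E(ℚ_p)` of
`exists_pointAddEquiv_adicCompletion_padic_comp`, with `φ'(Q_v) = φ(Q_p)` for `Q ∈ E(ℚ)`. [folklore] -/
theorem ReciprocityPT.exists_pointIdentification_adicCompletion_of_padic {p : ℕ} [Fact p.Prime]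
    (hpv : (p : 𝓞 ℚ) ∈ v.asIdeal) {q : ℕ} (φ : (W.baseChange ℚ_[p]).toAffine.Point →+ ZMod q)
    (hφ : Surjective φ) (hker : ∀ g, φ g = 0 ↔ ∃ h, q • h = g) :
    ∃ φ' : (W.baseChange (v.adicCompletion ℚ)).toAffine.Point →+ ZMod q,
      Surjective φ' ∧ (∀ g, φ' g = 0 ↔ ∃ h, q • h = g) ∧
      ∀ Q : W.toAffine.Point, φ' (Affine.Point.baseChange (W' := W) ℚ (v.adicCompletion ℚ) Q) =
        φ (Affine.Point.map (W' := W) (Algebra.ofId ℚ ℚ_[p]) Q) := by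
  obtain ⟨f, hf⟩ := exists_pointAddEquiv_adicCompletion_padic_comp W hpv
  refine ⟨φ.comp f.toAddMonoidHom, hφ.comp f.surjective, fun g => ?_, fun Q => ?_⟩
  · rw [AddMonoidHom.comp_apply, AddEquiv.coe_toAddMonoidHom, hker]
    constructor
    · rintro ⟨h, hh⟩
      exact ⟨f.symm h, f.injective (by rw [map_nsmul, AddEquiv.apply_symm_apply, hh])⟩
    · rintro ⟨h, rfl⟩
      exact ⟨f h, by rw [map_nsmul]⟩
  · rw [AddMonoidHom.comp_apply, AddEquiv.coe_toAddMonoidHom, hf Q]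

variable [W.IsGloballyMinimal]

/-- **Port at `ℓ`**: for a good `ℓ ∤ q` and an identification `φ : Ẽ(𝔽_ℓ) ↠ ℤ/q` with kernel `q·Ẽ(𝔽_ℓ)`,
`φ' := φ ∘ red ∘ f : E(ℚ_v) → ℤ/q` (`v ∋ ℓ`; `red` the tree's reduction homomorphism `exists_reductionHom`,
SURJECTIVE by `reducePoint_congrEquiv_surjective`, with `Q ∈ q·E(ℚ_ℓ) ⟺ Q̃ ∈ q·Ẽ(𝔽_ℓ)` by
`exists_nsmul_eq_iff_reduction`) is an identification `E(ℚ_v) ↠ ℤ/q` with kernel `q·E(ℚ_v)`, and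
`φ'((c·Q)_v) = φ(c·Q̃)` for `Q ∈ E(ℚ)`, `c ∈ ℕ` — i.e. `E(ℚ_ℓ)/q ≅ Ẽ(𝔽_ℓ)/q` in the form the depth-law files
consume. [cite: SilvermanAEC2009, Prop. VII.2.1 and Prop. VII.3.1(b)] -/
theorem ReciprocityPT.exists_pointIdentification_adicCompletion_of_reduction {ℓ : ℕ} [Fact ℓ.Prime]
    (hℓv : (ℓ : 𝓞 ℚ) ∈ v.asIdeal) (hgood : ¬ (ℓ : ℤ) ∣ minimalDiscriminantInt W) {q : ℕ} (hq : ¬ ℓ ∣ q)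
    (φ : (((integralModelInt W).map (Int.castRingHom ℤ_[ℓ])).map
      (IsLocalRing.residue ℤ_[ℓ])).toAffine.Point →+ ZMod q)
    (hφ : Surjective φ) (hker : ∀ g, φ g = 0 ↔ ∃ h, q • h = g) :
    ∃ φ' : (W.baseChange (v.adicCompletion ℚ)).toAffine.Point →+ ZMod q,
      Surjective φ' ∧ (∀ g, φ' g = 0 ↔ ∃ h, q • h = g) ∧
      ∀ (c : ℕ) (Q : W.toAffine.Point),
        φ' (Affine.Point.baseChange (W' := W) ℚ (v.adicCompletion ℚ) (c • Q)) =
          φ (c • reducePoint ((integralModelInt W).map (Int.castRingHom ℤ_[ℓ]))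
            (Affine.Point.congrEquiv (W.padicModel_baseChange ℓ).symm
              (Affine.Point.map (W' := W.toAffine) (Algebra.ofId ℚ ℚ_[ℓ]) Q))) := by
  obtain ⟨f, hf⟩ := exists_pointAddEquiv_adicCompletion_padic_comp W hℓv
  obtain ⟨r, hr⟩ := exists_reductionHom (W := W) (q := ℓ) hgood
  have hrsurj : Surjective r := fun c => by
    obtain ⟨P, hP⟩ := reducePoint_congrEquiv_surjective (W := W) (q := ℓ) c
    exact ⟨P, (hr P).trans hP⟩
  refine ⟨φ.comp (r.comp f.toAddMonoidHom), hφ.comp (hrsurj.comp f.surjective), fun g => ?_,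
    fun c Q => ?_⟩
  · rw [AddMonoidHom.comp_apply, AddMonoidHom.comp_apply, AddEquiv.coe_toAddMonoidHom, hker, hr,
      ← exists_nsmul_eq_iff_reduction hgood hq (f g)]
    constructor
    · rintro ⟨Q, hQ⟩
      exact ⟨f.symm Q, f.injective (by rw [map_nsmul, AddEquiv.apply_symm_apply, hQ])⟩
    · rintro ⟨h, rfl⟩
      exact ⟨f h, by rw [map_nsmul]⟩
  · have h1 : Affine.Point.baseChange (W' := W) ℚ (v.adicCompletion ℚ) (c • Q) =
        c • Affine.Point.baseChange (W' := W) ℚ (v.adicCompletion ℚ) Q :=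
      map_nsmul (Affine.Point.baseChange (W' := W) ℚ (v.adicCompletion ℚ)) c Q
    rw [AddMonoidHom.comp_apply, AddMonoidHom.comp_apply, AddEquiv.coe_toAddMonoidHom, h1, map_nsmul f,
      hf Q, map_nsmul r, hr]

omit [W.IsGloballyMinimal] in
/-- **Port at `p`, Kummer side**: an identification `φ : E(ℚ_p) ↠ ℤ/q` (kernel `q·E(ℚ_p)`, Mathlib's `ℚ_[p]`-points)
yields an identification `φL : 𝓛_v ≅ ℤ/q` of the Kummer condition at `v ∋ p` with `φL(loc_v κ_q Q) = φ(Q_p)` for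
every `Q ∈ E(ℚ)` (`ReciprocityPT.exists_addEquiv_kummer_of_pointIdentification` + the port above +
`loc_v κ(Q) = κ_v(Q_v)`). [cite: SilvermanAEC2009, X.§4 diagram (**)] -/
theorem ReciprocityPT.exists_kummerIdentification_of_padic {p : ℕ} [Fact p.Prime]
    (hpv : (p : 𝓞 ℚ) ∈ v.asIdeal) {q : ℕ} [NeZero q] (φ : (W.baseChange ℚ_[p]).toAffine.Point →+ ZMod q)
    (hφ : Surjective φ) (hker : ∀ g, φ g = 0 ↔ ∃ h, q • h = g) :
    ∃ φL : W.kummerSelmerStructure (q : ℤ) (Sum.inr v) ≃+ ZMod q,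
      ∀ Q : W.toAffine.Point,
        φL ⟨_, X11b.Relaxation.localization_kummerMapTorsion_mem W q (Sum.inr v) Q⟩ =
          φ (Affine.Point.map (W' := W.toAffine) (Algebra.ofId ℚ ℚ_[p]) Q) := by
  obtain ⟨φ', hφ', hker', hφ'Q⟩ :=
    ReciprocityPT.exists_pointIdentification_adicCompletion_of_padic W hpv φ hφ hker
  obtain ⟨φL, hφL⟩ := ReciprocityPT.exists_addEquiv_kummer_of_pointIdentification W q v φ' hφ' hker'
  refine ⟨φL, fun Q => ?_⟩
  have hk : (⟨_, X11b.Relaxation.localization_kummerMapTorsion_mem W q (Sum.inr v) Q⟩ :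
      W.kummerSelmerStructure (q : ℤ) (Sum.inr v)) =
        ⟨_, ReciprocityPT.localKummerMap_mem_kummerSelmerStructure W q v
          (Affine.Point.baseChange (W' := W) ℚ (v.adicCompletion ℚ) Q)⟩ :=
    Subtype.ext (ReciprocityPT.localization_kummerMapTorsion_eq_localKummerMap W q v Q)
  rw [hk, hφL]
  exact hφ'Q Q

/-- **Port at `ℓ`, Kummer side**: for a good `ℓ ∤ q` and an identification `φ : Ẽ(𝔽_ℓ) ↠ ℤ/q` (kernel `q·Ẽ(𝔽_ℓ)`)
there is an identification `φL : 𝓛_v ≅ ℤ/q` of the Kummer condition at `v ∋ ℓ` with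
`φL(loc_v κ_q (c·Q)) = φ(c·Q̃)` for every `Q ∈ E(ℚ)`, `c ∈ ℕ` — the classes of `Q` and `c·Q` read on `Ẽ(𝔽_ℓ)/q`,
exactly the arguments of `Ordinary/LocalClassOrders.lean`. [cite: SilvermanAEC2009, Prop. VII.2.1] -/
theorem ReciprocityPT.exists_kummerIdentification_of_reduction {ℓ : ℕ} [Fact ℓ.Prime]
    (hℓv : (ℓ : 𝓞 ℚ) ∈ v.asIdeal) (hgood : ¬ (ℓ : ℤ) ∣ minimalDiscriminantInt W) {q : ℕ} [NeZero q] (hq : ¬ ℓ ∣ q)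
    (φ : (((integralModelInt W).map (Int.castRingHom ℤ_[ℓ])).map
      (IsLocalRing.residue ℤ_[ℓ])).toAffine.Point →+ ZMod q)
    (hφ : Surjective φ) (hker : ∀ g, φ g = 0 ↔ ∃ h, q • h = g) :
    ∃ φL : W.kummerSelmerStructure (q : ℤ) (Sum.inr v) ≃+ ZMod q,
      ∀ (c : ℕ) (Q : W.toAffine.Point),
        φL ⟨_, X11b.Relaxation.localization_kummerMapTorsion_mem W q (Sum.inr v) (c • Q)⟩ =
          φ (c • reducePoint ((integralModelInt W).map (Int.castRingHom ℤ_[ℓ]))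
            (Affine.Point.congrEquiv (W.padicModel_baseChange ℓ).symm
              (Affine.Point.map (W' := W.toAffine) (Algebra.ofId ℚ ℚ_[ℓ]) Q))) := by
  obtain ⟨φ', hφ', hker', hφ'Q⟩ :=
    ReciprocityPT.exists_pointIdentification_adicCompletion_of_reduction W hℓv hgood hq φ hφ hker
  obtain ⟨φL, hφL⟩ := ReciprocityPT.exists_addEquiv_kummer_of_pointIdentification W q v φ' hφ' hker'
  refine ⟨φL, fun c Q => ?_⟩
  have hk : (⟨_, X11b.Relaxation.localization_kummerMapTorsion_mem W q (Sum.inr v) (c • Q)⟩ :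
      W.kummerSelmerStructure (q : ℤ) (Sum.inr v)) =
        ⟨_, ReciprocityPT.localKummerMap_mem_kummerSelmerStructure W q v
          (Affine.Point.baseChange (W' := W) ℚ (v.adicCompletion ℚ) (c • Q))⟩ :=
    Subtype.ext (ReciprocityPT.localization_kummerMapTorsion_eq_localKummerMap W q v (c • Q))
  rw [hk, hφL]
  exact hφ'Q c Q

end Port

/-! ### §2 The clause at `(ℓ, k)` on C-16's letter from the Kolyvagin class + Kim's reading -/

section Letter

variable (W : WeierstrassCurve ℚ) [W.IsElliptic] [W.IsGloballyMinimal] {N : ℕ} (f : CuspForm (Gamma0 N) 2)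
  (ℓ : ℕ) [Fact ℓ.Prime] (k : ℕ) (P : W.toAffine.Point) (F : ℕ)

/-- **C-16's clause at `(ℓ, k)` ON ITS LETTER from the KOLYVAGIN CLASS and KIM's READING alone** (the two named
facts Poitou–Tate and local Euler characteristic displayed as hypotheses). Letter clauses: `3` good, `a₃ ∉ {1, −2}`,
`m₃(P) = 0`, `ℓ` a cyclic Kolyvagin prime; `vℓ ∋ ℓ`, `v₃ ∋ 3` the two finite places. Per surjective `ψ` at level
`3^k`, the schema asks for: a depth `n ≥ k` with `ℓ ∈ 𝒫_n`; `u` with `3 ∤ u`; a class `x ∈ H¹(ℚ, E[3^n])` with the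
Kummer condition at every place `∉ {vℓ, v₃}`; an additive isomorphism `θ : 𝓛_{vℓ} ≅ H¹(ℚ_{vℓ}, E[3^n]) ⧸ 𝓛_{vℓ}`
with `[loc_{vℓ} x] = θ[loc_{vℓ} κ_{3^n}((3^F·u)·P)]` (the KS relation, `κ₁ = κ(3^F·u·P)`); and Kim's reading
`ord₃(δ̃_ℓ mod 3^k) = min(k, ord₃ ψ₃[loc_{v₃} x])` for every identification `ψ₃` of the singular quotient at `3`.
Conclusion: `KuriharaExactOrderAt W f ℓ k P F`. Proof: identifications `φ_ℓ` (`CyclicSylowQuotient`), `φ₃`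
(`LocalPointsIdentification`) ported to `ℚ_v` (§1); `ReciprocityPT.exists_singular_identifications_min_eq_min_of_facts`
(reciprocity + perfectness from the two facts) with the three local orders of `LocalClassOrders` / the `m₃ = 0`
clause gives `min(n, F + 2v) = min(n, ord ψ₃[loc₃ x])`; Kim's reading at `ψ₃`, `k ≤ n`.
[cite: MazurRubin2004, Thm. 3.2.4 and Thm. 5.2.12] [cite: Kim2022StructureSelmer, Thm. 3.13 and (5.3)]
[cite: MilneADT2006, Ch. I, Thm. 4.10(b), Cor. 2.3, Thm. 2.8] -/
theorem kuriharaExactOrderAt_of_letter_kolyvaginClass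
    (hgood : W.HasGoodReductionAtPrime 3) (ha1 : W.frobeniusTrace 3 ≠ 1) (ha2 : W.frobeniusTrace 3 ≠ -2)
    (hm0 : ¬ O5.PointLocallyThreeDivisibleAt W 3 P) (hcycℓ : IsCyclicKolyvaginLevel W 3 ℓ)
    {vℓ v₃ : HeightOneSpectrum (𝓞 ℚ)} (hvℓ : (ℓ : 𝓞 ℚ) ∈ vℓ.asIdeal) (hv₃ : ((3 : ℕ) : 𝓞 ℚ) ∈ v₃.asIdeal)
    (hPT : poitouTate_sum_localTatePairing_eq_zero ℚ)
    (hEPℓ : localEulerPoincareCharacteristic (vℓ.adicCompletion ℚ))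
    (hEP₃ : localEulerPoincareCharacteristic (v₃.adicCompletion ℚ))
    (h : ∀ ψ : (q : ℕ) → (ZMod q)ˣ →* Multiplicative (ZMod (3 ^ k)),
      (∀ q ∈ ℓ.primeFactors, Function.Surjective (ψ q)) →
        ∃ (n : ℕ) (_ : k ≤ n) (_ : Kato.IsKolyvaginPrime W 3 n ℓ) (u : ℕ) (_ : ¬ 3 ∣ u)
          (x : galoisCohomology (W.torsionGaloisModule ((3 ^ n : ℕ) : ℤ)) 1)
          (_ : x ∈ kummerOutside W (3 ^ n) {Sum.inr vℓ, Sum.inr v₃})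
          (θ : W.kummerSelmerStructure ((3 ^ n : ℕ) : ℤ) (Sum.inr vℓ) ≃+
            galoisCohomology ((W.torsionGaloisModule (3 ^ n : ℕ)).toLocal (Sum.inr vℓ)) 1 ⧸
              W.kummerSelmerStructure ((3 ^ n : ℕ) : ℤ) (Sum.inr vℓ)),
          (galoisCohomology.localization (W.torsionGaloisModule (3 ^ n : ℕ)) (Sum.inr vℓ) 1 x :
              galoisCohomology ((W.torsionGaloisModule (3 ^ n : ℕ)).toLocal (Sum.inr vℓ)) 1 ⧸
                W.kummerSelmerStructure ((3 ^ n : ℕ) : ℤ) (Sum.inr vℓ)) =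
            θ ⟨_, X11b.Relaxation.localization_kummerMapTorsion_mem W (3 ^ n) (Sum.inr vℓ) ((3 ^ F * u) • P)⟩ ∧
          ∀ ψ₃ : galoisCohomology ((W.torsionGaloisModule (3 ^ n : ℕ)).toLocal (Sum.inr v₃)) 1 ⧸
              W.kummerSelmerStructure ((3 ^ n : ℕ) : ℤ) (Sum.inr v₃) ≃+ ZMod (3 ^ n),
            (haveI : NeZero ℓ := ⟨(Fact.out : ℓ.Prime).ne_zero⟩
             zmodPowOrd 3 k (kuriharaNumber f (3 ^ k) ℓ ψ)) =
              min k (zmodPowOrd 3 n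
                (ψ₃ (galoisCohomology.localization (W.torsionGaloisModule (3 ^ n : ℕ)) (Sum.inr v₃) 1 x)))) :
    KuriharaExactOrderAt W f ℓ k P F := by
  haveI : NeZero ℓ := ⟨(Fact.out : ℓ.Prime).ne_zero⟩
  -- the cyclic-level clause read on the residue field of `ℤ_ℓ`
  have hcyc : Nat.card {c : (((integralModelInt W).map (Int.castRingHom ℤ_[ℓ])).map
      (IsLocalRing.residue ℤ_[ℓ])).toAffine.Point // 3 • c = 0} ≤ 3 := by
    rw [natCard_torsion_residue_eq_natCard_torsion_zmod W ℓ 3]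
    exact hcycℓ.2 ℓ dvd_rfl
  intro ψ hψ
  obtain ⟨n, hk, hKP, u, hu, x, hx, θ, hKS, hkim⟩ := h ψ hψ
  -- `ℓ ∈ 𝒫_n`: `ℓ ≠ 3`, `ℓ` good, `n ≤ e_ℓ`
  have hℓ3 : ℓ ≠ 3 := hKP.ne
  have hgoodℓ' : W.HasGoodReductionAtPrime ℓ := by
    by_contra hbad
    exact hKP.not_dvd_conductorNorm ((W.dvd_conductorNorm_iff_not_hasGoodReductionAtPrime ℓ).mpr hbad)
  have hgoodℓ : ¬ (ℓ : ℤ) ∣ minimalDiscriminantInt W :=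
    not_dvd_minimalDiscriminantInt_of_hasGoodReductionAtPrime' W ℓ hgoodℓ'
  have hn : n ≤ padicValNat 3 (W.reductionPointCount ℓ) :=
    (padicValNat_dvd_iff_le (reductionPointCount_ne_zero W ℓ)).mp hKP.pow_dvd_reductionPointCount
  -- depth `0`: nothing to prove
  rcases Nat.eq_zero_or_pos n with hn0 | hnpos
  · subst hn0
    obtain rfl : k = 0 := Nat.le_zero.mp hk
    have h0 := zmodPowOrd_le Nat.prime_three (n := 0) (kuriharaNumber f (3 ^ 0) ℓ ψ)
    omega
  -- the identifications `φ_ℓ : Ẽ(𝔽_ℓ) ↠ ℤ/3^n`, `φ₃ : E(ℚ₃) ↠ ℤ/3^n`, read on the Kummer conditions at `vℓ`, `v₃`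
  obtain ⟨φl, hφl, hkerl⟩ := exists_addMonoidHom_zmod_pow_reduction W 3 ℓ hcyc hn
  obtain ⟨φp, hφp, hkerp, -⟩ :=
    exists_addMonoidHom_zmod_pow_three_of_not_pointLocallyThreeDivisibleAt W hgood ha1 ha2 hm0 n
  have hq : ¬ ℓ ∣ 3 ^ n := fun hd =>
    hℓ3 ((Nat.prime_dvd_prime_iff_eq (Fact.out) Nat.prime_three).mp ((Fact.out : ℓ.Prime).dvd_of_dvd_pow hd))
  obtain ⟨φL₁, hφL₁⟩ :=
    ReciprocityPT.exists_kummerIdentification_of_reduction W hvℓ hgoodℓ hq φl hφl hkerl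
  obtain ⟨φL₂, hφL₂⟩ := ReciprocityPT.exists_kummerIdentification_of_padic W hv₃ φp hφp hkerp
  have hne : vℓ ≠ v₃ :=
    ReciprocityPT.ne_of_natCast_mem_asIdeal ((Nat.coprime_primes (Fact.out) Nat.prime_three).mpr hℓ3) hvℓ hv₃
  -- step (iii) from Poitou–Tate: `min(n, a + 2v) = min(n, ord ψ₃[loc₃ x] + m)` given the three local orders
  obtain ⟨ψ𝔭, H⟩ := ReciprocityPT.exists_singular_identification_min_eq_min_of_facts W 3 n hnpos hPT hne
    hEPℓ hEP₃ φL₁ φL₂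
  -- the three local orders (`LocalClassOrders`; `m₃(P) = 0`)
  have hxl : zmodPowOrd 3 n
      (φL₁ ⟨_, X11b.Relaxation.localization_kummerMapTorsion_mem W (3 ^ n) (Sum.inr vℓ) ((3 ^ F * u) • P)⟩) =
        min n (F + localDivExponent W 3 ℓ P) := by
    rw [hφL₁]
    exact zmodPowOrd_map_pow_mul_smul_reduction_eq W 3 ℓ hgoodℓ hℓ3 hcyc hn φl hφl hkerl P F hu
  have hyl : zmodPowOrd 3 n
      (φL₁ ⟨_, X11b.Relaxation.localization_kummerMapTorsion_mem W (3 ^ n) (Sum.inr vℓ) P⟩) =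
        min n (localDivExponent W 3 ℓ P) := by
    have h1 := hφL₁ 1 P
    simp only [one_nsmul] at h1
    rw [h1]
    exact zmodPowOrd_map_reduction_eq W 3 ℓ hgoodℓ hℓ3 hcyc hn φl hφl hkerl P
  have hyp : zmodPowOrd 3 n
      (φL₂ ⟨_, X11b.Relaxation.localization_kummerMapTorsion_mem W (3 ^ n) (Sum.inr v₃) P⟩) = min n 0 := by
    rw [hφL₂]
    exact zmodPowOrd_map_point_eq_zero_of_not_pointLocallyThreeDivisibleAt W P hgood ha1 ha2 hm0 φp hφp hkerp
  have hmin := H x hx P θ _ hKS hxl hyl hyp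
  rw [hkim ψ𝔭]
  rw [Nat.add_zero] at hmin
  -- `min k (min n t) = min k t` for `k ≤ n`
  have key : ∀ t s : ℕ, min n t = min n s → min k s = min k t := fun t s hts => by
    have := congrArg (min k) hts
    rwa [← min_assoc, ← min_assoc, min_eq_left hk, eq_comm] at this
  exact key _ _ hmin

end Letter

/-! ### §3 The closed sentence: C-16 from the Kolyvagin class + Kim's reading, quantified over its letter -/

section Closed

/-- **C-16 (closed sentence `KuriharaExactOrderRankOneAtThree`) FOLLOWS from the KOLYVAGIN-CLASS CORE quantified
over C-16's own letter**, given the two named facts (Poitou–Tate over `ℚ`; Tate's local Euler–Poincaré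
characteristic at every `ℚ_v`). The hypothesis `hcore` receives every binder of the closed sentence VERBATIM (as in
`kuriharaExactOrderRankOneAtThree_of_letter_reciprocity`) plus the two places `vℓ ∋ ℓ`, `v₃ ∋ 3`, and must return,
for every surjective `ψ`, the SMALLER per-level schema of `kuriharaExactOrderAt_of_letter_kolyvaginClass` with
`F = s + v₃ ∏ c_q`: a Kolyvagin class `x` Kummer outside `{vℓ, v₃}` with the KS relation to `κ((3^F·u)·P)` through
some comparison isomorphism, and Kim's reading of `δ̃_ℓ` on the singular part of `loc₃ x`. Compared with the sibling
the identifications, the perfect local pairings and the reciprocity law have LEFT the schema (now theorems resp. the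
two published facts). Nothing asserted; C-16 and the core stay OPEN (Kato's Kolyvagin system, Mazur–Rubin 3.2.4 /
5.2.12 at `p = 3`, Kim Thm. 3.13 at `p = 3`). [cite: MazurRubin2004, Thm. 3.2.4 and Thm. 5.2.12]
[cite: Kim2022StructureSelmer, Thm. 3.13 and (5.3)] [cite: MilneADT2006, Ch. I, Thm. 4.10(b) and Thm. 2.8] -/
theorem kuriharaExactOrderRankOneAtThree_of_letter_kolyvaginClass
    (hPT : poitouTate_sum_localTatePairing_eq_zero ℚ)
    (hEP : ∀ v : HeightOneSpectrum (𝓞 ℚ), localEulerPoincareCharacteristic (v.adicCompletion ℚ))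
    (hcore : ∀ (W : WeierstrassCurve ℚ) [W.IsElliptic] [W.IsGloballyMinimal],
      W.analyticRank = 1 →
      ∀ (P : W.toAffine.Point), ¬ IsOfFinAddOrder P →
        (∀ Q : W.toAffine.Point, ∃ n : ℤ, IsOfFinAddOrder (Q - n • P)) →
      (∀ T : W.toAffine.Point, 3 • T = 0 → T = 0) →
      W.HasSurjectiveModNGaloisRep 3 →
      W.HasGoodReductionAtPrime 3 → W.frobeniusTrace 3 ≠ 1 → W.frobeniusTrace 3 ≠ -2 →
      ¬ O5.PointLocallyThreeDivisibleAt W 3 P →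
      ∀ (q : ℚ) (s : ℕ), shaAn W = (q : ℂ) → padicValRat 3 q = s →
      ∀ {N : ℕ} [NeZero N] (D : ModularParametrizationData W N),
        ¬ (3 : ℤ) ∣ D.maninConstant →
        (∃ u : ℚ, ‖(u : ℚ_[3])‖ = 1 ∧ W.realPeriodRat = u * plusPeriod D.f) →
      ∀ (ℓ k : ℕ) [Fact ℓ.Prime], 1 ≤ k → Kato.IsKolyvaginPrime W 3 k ℓ →
        IsCyclicKolyvaginLevel W 3 ℓ →
      ∀ (vℓ v₃ : HeightOneSpectrum (𝓞 ℚ)), (ℓ : 𝓞 ℚ) ∈ vℓ.asIdeal → ((3 : ℕ) : 𝓞 ℚ) ∈ v₃.asIdeal →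
        ∀ ψ : (q : ℕ) → (ZMod q)ˣ →* Multiplicative (ZMod (3 ^ k)),
          (∀ q ∈ ℓ.primeFactors, Function.Surjective (ψ q)) →
            ∃ (n : ℕ) (_ : k ≤ n) (_ : Kato.IsKolyvaginPrime W 3 n ℓ) (u : ℕ) (_ : ¬ 3 ∣ u)
              (x : galoisCohomology (W.torsionGaloisModule ((3 ^ n : ℕ) : ℤ)) 1)
              (_ : x ∈ kummerOutside W (3 ^ n) {Sum.inr vℓ, Sum.inr v₃})
              (θ : W.kummerSelmerStructure ((3 ^ n : ℕ) : ℤ) (Sum.inr vℓ) ≃+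
                galoisCohomology ((W.torsionGaloisModule (3 ^ n : ℕ)).toLocal (Sum.inr vℓ)) 1 ⧸
                  W.kummerSelmerStructure ((3 ^ n : ℕ) : ℤ) (Sum.inr vℓ)),
              (galoisCohomology.localization (W.torsionGaloisModule (3 ^ n : ℕ)) (Sum.inr vℓ) 1 x :
                  galoisCohomology ((W.torsionGaloisModule (3 ^ n : ℕ)).toLocal (Sum.inr vℓ)) 1 ⧸
                    W.kummerSelmerStructure ((3 ^ n : ℕ) : ℤ) (Sum.inr vℓ)) =
                θ ⟨_, X11b.Relaxation.localization_kummerMapTorsion_mem W (3 ^ n) (Sum.inr vℓ)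
                  ((3 ^ (s + padicValNat 3 W.tamagawaProduct) * u) • P)⟩ ∧
              ∀ ψ₃ : galoisCohomology ((W.torsionGaloisModule (3 ^ n : ℕ)).toLocal (Sum.inr v₃)) 1 ⧸
                  W.kummerSelmerStructure ((3 ^ n : ℕ) : ℤ) (Sum.inr v₃) ≃+ ZMod (3 ^ n),
                (haveI : NeZero ℓ := ⟨(Fact.out : ℓ.Prime).ne_zero⟩
                 zmodPowOrd 3 k (kuriharaNumber D.f (3 ^ k) ℓ ψ)) =
                  min k (zmodPowOrd 3 n
                    (ψ₃ (galoisCohomology.localization (W.torsionGaloisModule (3 ^ n : ℕ)) (Sum.inr v₃) 1 x)))) :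
    KuriharaExactOrderRankOneAtThree := by
  intro W _ _ hr P hP hgen htors hsurj hgood ha1 ha2 hm0 q s hq hs N _ D hManin hper ℓ k _ hk hKP hcyc
  set vℓ : HeightOneSpectrum (𝓞 ℚ) := (Rat.HeightOneSpectrum.primesEquiv (R := 𝓞 ℚ)).symm ⟨ℓ, Fact.out⟩
    with hvℓdef
  set v₃ : HeightOneSpectrum (𝓞 ℚ) := (Rat.HeightOneSpectrum.primesEquiv (R := 𝓞 ℚ)).symm ⟨3, Nat.prime_three⟩
    with hv₃def
  have hvℓ : (ℓ : 𝓞 ℚ) ∈ vℓ.asIdeal := (natCast_mem_asIdeal_iff_eq_primesEquiv_symm vℓ Fact.out).mpr hvℓdef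
  have hv₃ : ((3 : ℕ) : 𝓞 ℚ) ∈ v₃.asIdeal :=
    (natCast_mem_asIdeal_iff_eq_primesEquiv_symm v₃ Nat.prime_three).mpr hv₃def
  exact kuriharaExactOrderAt_of_letter_kolyvaginClass W D.f ℓ k P _ hgood ha1 ha2 hm0 hcyc hvℓ hv₃ hPT
    (hEP vℓ) (hEP v₃) (hcore W hr P hP hgen htors hsurj hgood ha1 ha2 hm0 q s hq hs D hManin hper ℓ k hk hKP hcyc
      vℓ v₃ hvℓ hv₃)

end Closed

end Summit.BirchSwinnertonDyer.Rank1Residual.Ordinary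

end
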